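import Mathlib
import Summits.PneNP.PneNP.Theorems.ConvexRankGatesConvexGateBlindAffineUnique

/-!
# PneNP / ConvexRankGates — `ConvexGateBlind`: dual-affine PSD pencils — every direction refutes at most ONE bare clique

Helpers (`--supports stmt-PneNP-10680`), COLUMN-SPACE line (prover seat 2, session 24): the PSD counterpart of the transposed
restricted class. In the canonical form of the crux the PSD term is `tr(H_u Y_Q)` with `H_u ⪰ 0` indexed by the `k`-clique-free
graphs; the DUAL-AFFINE class takes `H_u = H(1_u)` for an affine `q × q` pencil `H(x) = H₀ − ∑_e x_e H_e` that is PSD on every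
`k`-clique-free graph (a lift-free spectrahedron containing the `k`-clique-free polytope). For every vector `y` the scalar
function `x ↦ yᵀH(x)y = yᵀH₀y − ∑_e x_e · yᵀH_e y` is then a VALID AFFINE INEQUALITY of the clique-free polytope, so by the
uniqueness of the caught clique (`valid_inequality_catches_one`, `…AffineUnique.lean`):

* `pencil_direction_catches_one` — **for `3 ≤ k` and every `y`, at most one `k`-set `Q` has `yᵀ H(1_{E(Q)}) y < 0`**: the
  negative cones `N_Q = {y : yᵀH(1_{E(Q)})y < 0}` of the pencil at distinct bare cliques are PAIRWISE DISJOINT — every direction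
  refutes at most one clique.
This is all that uniqueness gives on the PSD side, and it is genuinely all: one `2 × 2` pencil (a single second-order-cone
constraint) can already be PSD on every triangle-free graph of `K_7` and non-PSD at all seven Fano triangles
(`Φ(x) = (2η + (1−η)|x|, ∑_e x_e w_{L(e)})`, `w_j = e^{2πij/7}`, `η = 0.015`; memo ANALYSIS-seat2-s24 §2), so the pencil
exclusion number `c(q) = max #{Q : H(1_{E(Q)}) ⋡ 0}` is not bounded by `q`; whether `c(q) ≤ poly(q, m)` — which would make
every dual-affine PSD+LP refutation of the crux superpolynomial — is the open sub-question this file makes precise. [new]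
-/

set_option linter.dupNamespace false

namespace Summit.PneNP.PneNP.Theorems

open Finset Real Filter Matrix Literature.Computability.Complexity
open Summit.PneNP.PneNP.Cruxes.ConvexGateBlind.StrictRankConicCover (Edge cdist)

noncomputable section

variable {m : ℕ}

/-- The quadratic form of an affine pencil along `y` is the affine function `yᵀH₀y − ∑_e [c e]·yᵀH_e y` of the graph. [folklore] -/
theorem dotProduct_pencil_mulVec {q : ℕ} (H₀ : Matrix (Fin q) (Fin q) ℝ) (He : Edge m → Matrix (Fin q) (Fin q) ℝ)
    (c : Edge m → Bool) (y : Fin q → ℝ) :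
    y ⬝ᵥ ((H₀ - ∑ e, if c e = true then He e else 0) *ᵥ y) =
      y ⬝ᵥ (H₀ *ᵥ y) - ∑ e, (if c e = true then y ⬝ᵥ (He e *ᵥ y) else 0) := by
  rw [Matrix.sub_mulVec, dotProduct_sub, Matrix.sum_mulVec, dotProduct_sum]
  congr 1
  refine Finset.sum_congr rfl fun e _ => ?_
  split_ifs <;> simp

/-- **Every direction refutes at most one bare clique.** Let `3 ≤ k` and let `H(x) = H₀ − ∑_e x_e H_e` be a `q × q` affine
pencil that is positive semidefinite on every `k`-clique-free graph. Then for every `y : Fin q → ℝ`, at most one `k`-set `Q`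
has `yᵀ H(1_{E(Q)}) y < 0` (the negative cones of the pencil at distinct bare cliques are pairwise disjoint): `x ↦ yᵀH(x)y` is a
valid affine inequality of the clique-free polytope, and `valid_inequality_catches_one` applies. [new] -/
theorem pencil_direction_catches_one {k q : ℕ} (hk : 3 ≤ k) (H₀ : Matrix (Fin q) (Fin q) ℝ)
    (He : Edge m → Matrix (Fin q) (Fin q) ℝ)
    (hvalid : ∀ u : Edge m → Bool, cliqueFn m k u = false → (H₀ - ∑ e, if u e = true then He e else 0).PosSemidef)
    (y : Fin q → ℝ) {Q Q' : Finset (Fin m)} (hQ : Q.card = k) (hQ' : Q'.card = k)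
    (hcQ : y ⬝ᵥ ((H₀ - ∑ e, if cliqueVec Q e = true then He e else 0) *ᵥ y) < 0)
    (hcQ' : y ⬝ᵥ ((H₀ - ∑ e, if cliqueVec Q' e = true then He e else 0) *ᵥ y) < 0) : Q = Q' := by
  set t : Edge m → ℝ := fun e => y ⬝ᵥ (He e *ᵥ y) with ht
  set a : ℝ := y ⬝ᵥ (H₀ *ᵥ y) with ha
  have hform : ∀ c : Edge m → Bool, y ⬝ᵥ ((H₀ - ∑ e, if c e = true then He e else 0) *ᵥ y) =
      a - ∑ e, (if c e = true then t e else 0) := fun c => dotProduct_pencil_mulVec H₀ He c y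
  refine valid_inequality_catches_one hk t a (fun u hu => ?_) Q Q' hQ hQ' ?_ ?_
  · have h := (hvalid u hu).dotProduct_mulVec_nonneg y
    rw [star_trivial, hform u] at h
    linarith
  · rw [hform] at hcQ; linarith
  · rw [hform] at hcQ'; linarith

/-- **Every direction refutes at most one bare clique** (registered form of `pencil_direction_catches_one`). [new] -/
theorem pencil_negative_cones_disjoint : ∀ {m k q : ℕ}, 3 ≤ k → ∀ (H₀ : Matrix (Fin q) (Fin q) ℝ) (He : Edge m → Matrix (Fin q) (Fin q) ℝ), (∀ u : Edge m → Bool, cliqueFn m k u = false → (H₀ - ∑ e, if u e = true then He e else 0).PosSemidef) → ∀ (y : Fin q → ℝ) (Q Q' : Finset (Fin m)), Q.card = k → Q'.card = k → y ⬝ᵥ ((H₀ - ∑ e, if cliqueVec Q e = true then He e else 0) *ᵥ y) < 0 → y ⬝ᵥ ((H₀ - ∑ e, if cliqueVec Q' e = true then He e else 0) *ᵥ y) < 0 → Q = Q' :=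
  fun hk H₀ He hvalid y _ _ hQ hQ' hcQ hcQ' => pencil_direction_catches_one hk H₀ He hvalid y hQ hQ' hcQ hcQ'

end

end Summit.PneNP.PneNP.Theorems
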